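import Summits.BirchSwinnertonDyer.Rank1Residual.X11b.BDPRouteCyclotomicLever
import Summits.BirchSwinnertonDyer.Rank1Residual.X11b.ClassClosureTyped
import Literature.NumberTheory.EllipticCurves.Rank1Residual.Typed.Basic
import HarnessLib

/-!
# Class X11b, route p2: the one-sided cyclotomic lever, part 2 — class level: Kato's divisibility
# (Wuthrich 2014 Thm. 3) supplies the divisibility, every datum is instantiated from tree theorems /
# named facts; `Typed.MissingUpperBoundAt W p` on every surjective rank-one pair at a multiplicative
# `p` modulo ONE `p`-adic height per pair (cell `b2b-bsdres`, sub-cell `multr1-p2`, gen 21)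

HONEST FRAMING (verbatim, cell `b2b-bsdres`, run/shared/lean/b2b/bsd-rank1-residual/): the goal of
the cell is to DELETE the COMBINATION-SHAPED residual classes for ALL analytic-rank `≤ 1` curves
over `ℚ` — "full BSD formula for every rank `≤ 1` curve in class `C`" assembled STRICTLY from
published theorems — so that the rank-`≤ 1` remainder becomes exactly the CONSTRUCTION-SHAPED
classes, which are TYPED (missing-input Props), NOT attempted; this is not "finishing BSD".
Research route `p2` for class X11b (`ClassX11b W p := r_an = 1 ∧ p ≠ 2 ∧ mult(p) ∧ irr(p)`,
`Partition/Rows.lean`); no claim beyond the stated class and loci; nothing booked; X11b stays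
CONSTRUCTION-SHAPED. THEOREMS ONLY (no definition, no named fact, no `sorry`). Every theorem is
CONDITIONAL on the published named facts it lists, on THE open input of the route where stated, and
on the per-pair input `SchneiderConjecture Dh` / `ClassClosure.RegulatorNonvanishingAt W p`
(`Reg_p(E) ≠ 0` for THE canonical `p`-adic height: a finite `p`-adic computation per pair —
class-wide it is Schneider's conjecture, OPEN; barrier file
`Literature/Barriers/BirchSwinnertonDyer/PAdicHeightNondegeneracyProofs.lean`).

## What this file does (part 2 of 3; part 1 = `X11b/BDPRouteCyclotomicLever.lean`)

* `finite_sha_and_padicValNat_shaOrder_le_of_katoSurj_nonsplit_of_schneider` /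
  `missingUpperBoundAt_of_katoSurj_nonsplit_of_schneider` — NON-SPLIT multiplicative `p`, ANY odd
  `p` (so `p = 3` included), `ρ̄_{E,p^n}` onto for all `n`: the Euler-system half
  `ord_p #Ш(E) ≤ ord_p #Ш(E)_an` from Kato's divisibility (`hK`), Stein–Wuthrich Thm. 6.1 (`hJ`) and
  §4.2 height existence (`hH`), Disegni Thm. 1 (`hD`), GZK, modularity (`hpar`), and
  `SchneiderConjecture Dh` for THE §4.2 datum of the pair. NO (ram), NO semistability, ANY `#Ш_an`.
* `…_of_katoSurj_split_of_schneider` — SPLIT `p ≥ 5` with a second multiplicative prime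
  (Disegni's (∗)); `𝓛_p ≠ 0` is a tree theorem.
* `missingUpperBoundAt_of_katoSurj_of_regulatorNonvanishing` — both signs at `p ≥ 5` from
  `Surj W p` (Serre's step, tree theorem) with the class-closure lane's per-pair predicate
  `ClassClosure.RegulatorNonvanishingAt W p`.
Part 3 (`BDPRouteCyclotomicRecord`) composes these with the route's open input. Labels UNCHANGED;
nothing booked; X11b stays CONSTRUCTION-SHAPED.

References: [Wuthrich2014] Thm. 3, Cor. 19 (proof, p. 399); [SteinWuthrich2013] Thm. 6.1, §4.2;
[Disegni2020] Thm. 1, (∗); [SerreAbelianLadic1968] IV §3.4; [Miller2011LMS] Def. 1.1.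
-/

set_option autoImplicit false

noncomputable section

open scoped Classical MatrixGroups ModularForm

open CongruenceSubgroup WeierstrassCurve
open Literature.NumberTheory.EllipticCurves
  Literature.NumberTheory.EllipticCurves.ModularForms
  Literature.NumberTheory.EllipticCurves.Rank1Residual
  Literature.NumberTheory.EllipticCurves.Rank1Residual.Typed
  Literature.NumberTheory.EllipticCurves.Wuthrich2014
  Literature.NumberTheory.EllipticCurves.SteinWuthrich2013
  Literature.NumberTheory.EllipticCurves.Disegni2020
  Literature.NumberTheory.EllipticCurves.Skinner2016

namespace Summit.BirchSwinnertonDyer.Rank1Residual.X11b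

/-! ### §2. Class level: Kato's divisibility supplies the divisibility, every datum instantiated -/

section Class

variable (W : WeierstrassCurve ℚ) [W.IsElliptic] [W.IsGloballyMinimal] (p : ℕ) [Fact p.Prime]

/-- **The Euler-system half at a NON-SPLIT multiplicative prime, ANY odd `p` (so `p = 3` included),
for a curve with onto `p`-adic image, from PUBLISHED named facts and ONE per-pair input.** For
`E/ℚ` (globally minimal `W`) with `ord_{s=1} L(E,s) = 1`, `p ≠ 2` non-split multiplicative,
`ρ̄_{E,p^n}` onto for every `n` (`hρ`; at `p ≥ 5` this is `Surj W p`, Serre): `Ш(E/ℚ)` is finite and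
`ord_p #Ш(E/ℚ) ≤ ord_p s` for every rational `s = #Ш(E)_an`, from Kato's divisibility at an odd
multiplicative prime (Wuthrich 2014 Thm. 3, `hK`), Stein–Wuthrich 2013 Thm. 6.1 non-split (`hJ`)
and §4.2 height existence (`hH`), Disegni 2020 Thm. 1 non-split (`hD`), GZK (`hGZK`), modularity
(`hpar`), and the per-pair input `SchneiderConjecture Dh` for THE §4.2 datum (quantified over the
pinned data; unique, `IsMultCanonical.unique`). NO (ram), NO semistability, NO Tamagawa / Heegner
hypothesis, ANY `#Ш_an`. CONDITIONAL; nothing booked.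
[cite: Wuthrich2014, Thm. 3 (p. 383), Cor. 19 (p. 398)] [cite: Kato2004Asterisque, Thm. 17.4]
[cite: SteinWuthrich2013, Thm. 6.1 (p. 20), §4.2] [cite: Disegni2020, Thm. 1 (§1.2)]
[cite: Miller2011LMS, Def. 1.1] -/
theorem finite_sha_and_padicValNat_shaOrder_le_of_katoSurj_nonsplit_of_schneider
    (hK : kato_charIdeal_dvd_multiplicative_of_surjective) (hJ : thm61_nonsplitMultiplicative)
    (hH : exists_isMultCanonical) (hD : thm1_padicBSD_rankOne_multiplicative)
    (hGZK : rank_eq_analyticRank_of_analyticRank_le_one)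
    (hpar : nonempty_modularParametrizationData)
    (hp : p ≠ 2) (hmult : W.HasMultiplicativeReductionAtPrime p)
    (hns : ¬ W.HasSplitMultiplicativeReductionAtPrime p) (hr : W.analyticRank = 1)
    (hρ : ∀ n : ℕ, W.HasSurjectiveModNGaloisRep (p ^ n : ℕ))
    (hSch : ∀ (q : ℚ_[p]) (Dh : PAdicHeightData W p), q ≠ 0 → ‖q‖ < 1 → tateJ q = (W.j : ℚ_[p]) →
      IsMultCanonical Dh q → SchneiderConjecture Dh)
    {s : ℚ} (hs : shaAn W = (s : ℂ)) :
    Finite W.sha ∧ (padicValNat p W.shaOrder : ℤ) ≤ padicValRat p s := by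
  -- data from tree theorems
  obtain ⟨κ, hκ, γ, hγ, hγ'⟩ := exists_isCyclotomic_isTopGenerator_isCyclotomicVariable_holds p
  obtain ⟨D⟩ := W.nonempty_selmerDualData_holds κ γ hγ
  haveI : NeZero (W.conductorNorm ℤ) := ⟨(W.conductorNorm_pos_holds).ne'⟩
  obtain ⟨Dm⟩ := hpar W
  obtain ⟨ϖ, hϖpos, hϖ, -⟩ := Dm.exists_rat_mul_realPeriodRat_eq_plusPeriod
  obtain ⟨L, hL⟩ := exists_isMultPAdicLFunctionOf_neg_one_of_nonsplit Dm.isNewformOf hmult hns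
  obtain ⟨q, ⟨hq0, hq1, hqj⟩, -⟩ := existsUnique_tateJ_eq_of_one_lt_norm
    (one_lt_norm_j_of_hasMultiplicativeReductionAtPrime (W := W) (p := p) hmult)
  obtain ⟨Dh, hDh⟩ := hH W p hp hmult hns q hq0 hq1 hqj
  -- Kato's divisibility for this data (non-split clause)
  obtain ⟨hXt, hnsp, -⟩ := hK W p hp hmult hρ hκ hγ hγ' Dm.isNewformOf D ϖ hϖ
  obtain ⟨g', hg', hdiv'⟩ := hnsp hns L hL
  -- a generator of the (principal) characteristic ideal, and the cofactor
  obtain ⟨g, hg⟩ := (charIdeal_isPrincipal_holds p D.X).principal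
  have hchar : D.charIdeal = Ideal.span {g} := hg
  rw [hchar] at hg'
  obtain ⟨h, hgh⟩ := Ideal.mem_span_singleton'.mp hg'
  have hdiv : iwasawaToPowerSeries p (g * h) = PowerSeries.C ((ϖ : ℚ) : ℚ_[p]) * L := by
    rw [mul_comm, hgh]; exact hdiv'
  -- Disegni's relative display at the pair (non-split clause)
  obtain ⟨s', u', hs', hDis⟩ := thm1_padicBSD_rankOne_multiplicative.nonsplit hD W p hp hmult hr
    Dm.isNewformOf ϖ hϖpos.ne' hϖ hns hq0 hq1 hqj L hL Dh hDh
  have hss : s' = s := by exact_mod_cast hs'.symm.trans hs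
  subst hss
  exact finite_sha_and_padicValNat_shaOrder_le_of_nonsplit_divisibility W p hJ hGZK hp hr hmult hns
    hq0 hq1 hqj hκ hγ hγ' D hXt hchar h hdiv Dh hDh hs u' hDis (hSch q Dh hq0 hq1 hqj hDh)

/-- `Typed.MissingUpperBoundAt` packaging of
`finite_sha_and_padicValNat_shaOrder_le_of_katoSurj_nonsplit_of_schneider` (the rational
`#Ш_an` is supplied by Disegni's display itself). [cite: Disegni2020, Thm. 1 (§1.2)]
[cite: Miller2011LMS, Def. 1.1] -/
theorem missingUpperBoundAt_of_katoSurj_nonsplit_of_schneider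
    (hK : kato_charIdeal_dvd_multiplicative_of_surjective) (hJ : thm61_nonsplitMultiplicative)
    (hH : exists_isMultCanonical) (hD : thm1_padicBSD_rankOne_multiplicative)
    (hGZK : rank_eq_analyticRank_of_analyticRank_le_one)
    (hpar : nonempty_modularParametrizationData)
    (hp : p ≠ 2) (hmult : W.HasMultiplicativeReductionAtPrime p)
    (hns : ¬ W.HasSplitMultiplicativeReductionAtPrime p) (hr : W.analyticRank = 1)
    (hρ : ∀ n : ℕ, W.HasSurjectiveModNGaloisRep (p ^ n : ℕ))
    (hSch : ∀ (q : ℚ_[p]) (Dh : PAdicHeightData W p), q ≠ 0 → ‖q‖ < 1 → tateJ q = (W.j : ℚ_[p]) →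
      IsMultCanonical Dh q → SchneiderConjecture Dh) :
    Typed.MissingUpperBoundAt W p := by
  -- a rational value of `#Ш_an` (from Disegni's display at any admissible data)
  haveI : NeZero (W.conductorNorm ℤ) := ⟨(W.conductorNorm_pos_holds).ne'⟩
  obtain ⟨Dm⟩ := hpar W
  obtain ⟨ϖ, hϖpos, hϖ, -⟩ := Dm.exists_rat_mul_realPeriodRat_eq_plusPeriod
  obtain ⟨L, hL⟩ := exists_isMultPAdicLFunctionOf_neg_one_of_nonsplit Dm.isNewformOf hmult hns
  obtain ⟨q, ⟨hq0, hq1, hqj⟩, -⟩ := existsUnique_tateJ_eq_of_one_lt_norm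
    (one_lt_norm_j_of_hasMultiplicativeReductionAtPrime (W := W) (p := p) hmult)
  obtain ⟨Dh, hDh⟩ := hH W p hp hmult hns q hq0 hq1 hqj
  obtain ⟨s, -, hs, -⟩ := thm1_padicBSD_rankOne_multiplicative.nonsplit hD W p hp hmult hr
    Dm.isNewformOf ϖ hϖpos.ne' hϖ hns hq0 hq1 hqj L hL Dh hDh
  exact ⟨s, hs, (finite_sha_and_padicValNat_shaOrder_le_of_katoSurj_nonsplit_of_schneider W p hK hJ
    hH hD hGZK hpar hp hmult hns hr hρ hSch hs).2⟩

/-- **The Euler-system half at a SPLIT multiplicative prime `p ≥ 5` with a SECOND multiplicative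
prime (Disegni's hypothesis (∗)), onto `p`-adic image, from PUBLISHED named facts and ONE per-pair
input.** As `finite_sha_and_padicValNat_shaOrder_le_of_katoSurj_nonsplit_of_schneider` with Kato's split
clause (`ι(T·g) = ϖ·L`, `g ∈ char_Λ X`), Stein–Wuthrich Thm. 6.1 split (`hJ`), split-height
existence (`hH`), Disegni Thm. 1 split (`hD`: `p ≥ 5`, `E[p]` irreducible is implied by `hρ` but
carried as `hirr`, a second multiplicative prime `hm`); `𝓛_p ≠ 0` a tree theorem. CONDITIONAL;
nothing booked. [cite: Wuthrich2014, Thm. 3 (p. 383), Cor. 19 (p. 398)]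
[cite: SteinWuthrich2013, Thm. 6.1 (p. 20), §4.2] [cite: Disegni2020, Thm. 1 (§1.2), hypothesis (∗)]
[cite: Miller2011LMS, Def. 1.1] -/
theorem finite_sha_and_padicValNat_shaOrder_le_of_katoSurj_split_of_schneider
    (hK : kato_charIdeal_dvd_multiplicative_of_surjective) (hJ : thm61_splitMultiplicative)
    (hH : exists_isSplitMultCanonical) (hD : thm1_padicBSD_rankOne_multiplicative)
    (hGZK : rank_eq_analyticRank_of_analyticRank_le_one)
    (hpar : nonempty_modularParametrizationData)
    (hp5 : 5 ≤ p) (hmult : W.HasMultiplicativeReductionAtPrime p)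
    (hsplit : W.HasSplitMultiplicativeReductionAtPrime p) (hr : W.analyticRank = 1)
    (hρ : ∀ n : ℕ, W.HasSurjectiveModNGaloisRep (p ^ n : ℕ))
    (hm : ∃ (m : ℕ) (_ : Fact m.Prime), m ≠ p ∧ W.HasMultiplicativeReductionAtPrime m)
    (hSch : ∀ (Dq : TateParameterData W p) (Dh : PAdicHeightData W p),
      IsSplitMultCanonical Dh Dq → SchneiderConjecture Dh)
    {s : ℚ} (hs : shaAn W = (s : ℂ)) :
    Finite W.sha ∧ (padicValNat p W.shaOrder : ℤ) ≤ padicValRat p s := by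
  have hp2 : p ≠ 2 := by omega
  obtain ⟨κ, hκ, γ, hγ, hγ'⟩ := exists_isCyclotomic_isTopGenerator_isCyclotomicVariable_holds p
  obtain ⟨D⟩ := W.nonempty_selmerDualData_holds κ γ hγ
  haveI : NeZero (W.conductorNorm ℤ) := ⟨(W.conductorNorm_pos_holds).ne'⟩
  obtain ⟨Dm⟩ := hpar W
  obtain ⟨ϖ, hϖpos, hϖ, -⟩ := Dm.exists_rat_mul_realPeriodRat_eq_plusPeriod
  obtain ⟨L, hL⟩ := exists_isSplitMultPAdicLFunctionOf hsplit Dm.isNewformOf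
  obtain ⟨Dq⟩ := (nonempty_tateParameterData_iff_holds (W := W) (p := p)).mpr hsplit
  obtain ⟨Dh, hDh⟩ := hH W p hp2 Dq
  -- Kato's divisibility for this data (split clause: `ι(T·g') = ϖ·L`)
  obtain ⟨hXt, -, hsp⟩ := hK W p hp2 hmult hρ hκ hγ hγ' Dm.isNewformOf D ϖ hϖ
  obtain ⟨g', hg', hdiv'⟩ := hsp hsplit L hL
  obtain ⟨g, hg⟩ := (charIdeal_isPrincipal_holds p D.X).principal
  have hchar : D.charIdeal = Ideal.span {g} := hg
  rw [hchar] at hg'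
  obtain ⟨h, hgh⟩ := Ideal.mem_span_singleton'.mp hg'
  have hdiv : iwasawaToPowerSeries p ((PowerSeries.X : IwasawaAlgebra p) * g * h) =
      PowerSeries.C ((ϖ : ℚ) : ℚ_[p]) * L := by
    rw [show (PowerSeries.X : IwasawaAlgebra p) * g * h = PowerSeries.X * g' by rw [← hgh]; ring]
    exact hdiv'
  -- Disegni's relative display at the pair (split clause, hypothesis (∗))
  obtain ⟨s', u', hs', hDis⟩ := thm1_padicBSD_rankOne_multiplicative.split hD W p hp2 hmult hr
    Dm.isNewformOf ϖ hϖpos.ne' hϖ hsplit hp5 hm Dq L hL Dh hDh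
  have hss : s' = s := by exact_mod_cast hs'.symm.trans hs
  subst hss
  exact finite_sha_and_padicValNat_shaOrder_le_of_split_divisibility W p hJ hGZK hp2 hr Dq hκ hγ hγ'
    D hXt hchar h hdiv Dh hDh hs u' hDis (hSch Dq Dh hDh)

/-- `Typed.MissingUpperBoundAt` packaging of
`finite_sha_and_padicValNat_shaOrder_le_of_katoSurj_split_of_schneider`.
[cite: Disegni2020, Thm. 1 (§1.2), hypothesis (∗)] [cite: Miller2011LMS, Def. 1.1] -/
theorem missingUpperBoundAt_of_katoSurj_split_of_schneider
    (hK : kato_charIdeal_dvd_multiplicative_of_surjective) (hJ : thm61_splitMultiplicative)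
    (hH : exists_isSplitMultCanonical) (hD : thm1_padicBSD_rankOne_multiplicative)
    (hGZK : rank_eq_analyticRank_of_analyticRank_le_one)
    (hpar : nonempty_modularParametrizationData)
    (hp5 : 5 ≤ p) (hmult : W.HasMultiplicativeReductionAtPrime p)
    (hsplit : W.HasSplitMultiplicativeReductionAtPrime p) (hr : W.analyticRank = 1)
    (hρ : ∀ n : ℕ, W.HasSurjectiveModNGaloisRep (p ^ n : ℕ))
    (hm : ∃ (m : ℕ) (_ : Fact m.Prime), m ≠ p ∧ W.HasMultiplicativeReductionAtPrime m)
    (hSch : ∀ (Dq : TateParameterData W p) (Dh : PAdicHeightData W p),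
      IsSplitMultCanonical Dh Dq → SchneiderConjecture Dh) :
    Typed.MissingUpperBoundAt W p := by
  have hp2 : p ≠ 2 := by omega
  haveI : NeZero (W.conductorNorm ℤ) := ⟨(W.conductorNorm_pos_holds).ne'⟩
  obtain ⟨Dm⟩ := hpar W
  obtain ⟨ϖ, hϖpos, hϖ, -⟩ := Dm.exists_rat_mul_realPeriodRat_eq_plusPeriod
  obtain ⟨L, hL⟩ := exists_isSplitMultPAdicLFunctionOf hsplit Dm.isNewformOf
  obtain ⟨Dq⟩ := (nonempty_tateParameterData_iff_holds (W := W) (p := p)).mpr hsplit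
  obtain ⟨Dh, hDh⟩ := hH W p hp2 Dq
  obtain ⟨s, -, hs, -⟩ := thm1_padicBSD_rankOne_multiplicative.split hD W p hp2 hmult hr
    Dm.isNewformOf ϖ hϖpos.ne' hϖ hsplit hp5 hm Dq L hL Dh hDh
  exact ⟨s, hs, (finite_sha_and_padicValNat_shaOrder_le_of_katoSurj_split_of_schneider W p hK hJ hH
    hD hGZK hpar hp5 hmult hsplit hr hρ hm hSch hs).2⟩

/-- **The Euler-system half on a surjective rank-one pair at a multiplicative `p ≥ 5`, both signs
of `a_p`**, with the per-pair regulator input in the class-closure lane's shape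
`ClassClosure.RegulatorNonvanishingAt W p` and Disegni's (∗) as the hypothesis `hstar` (a second
multiplicative prime IF split at `p`). `Surj W p` gives the onto `p`-adic image (Serre, tree
theorem). CONDITIONAL; nothing booked. [cite: Wuthrich2014, Thm. 3, Cor. 19 proof (p. 399)]
[cite: SteinWuthrich2013, Thm. 6.1, §4.2] [cite: Disegni2020, Thm. 1 (§1.2), hypothesis (∗)]
[cite: SerreAbelianLadic1968, Ch. IV §3.4] [cite: Miller2011LMS, Def. 1.1] -/
theorem missingUpperBoundAt_of_katoSurj_of_regulatorNonvanishing
    (hK : kato_charIdeal_dvd_multiplicative_of_surjective)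
    (hJn : thm61_nonsplitMultiplicative) (hJs : thm61_splitMultiplicative)
    (hHn : exists_isMultCanonical) (hHs : exists_isSplitMultCanonical)
    (hD : thm1_padicBSD_rankOne_multiplicative)
    (hGZK : rank_eq_analyticRank_of_analyticRank_le_one)
    (hpar : nonempty_modularParametrizationData)
    (hp5 : 5 ≤ p) (hmult : W.HasMultiplicativeReductionAtPrime p) (hr : W.analyticRank = 1)
    (hsurj : Surj W p)
    (hstar : W.HasSplitMultiplicativeReductionAtPrime p →
      ∃ (m : ℕ) (_ : Fact m.Prime), m ≠ p ∧ W.HasMultiplicativeReductionAtPrime m)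
    (hReg : ClassClosure.RegulatorNonvanishingAt W p) :
    Typed.MissingUpperBoundAt W p := by
  have hρ := kato_charIdeal_dvd_multiplicative_of_surjective.surjective_pow_of_five_le W p hp5 hsurj
  by_cases hsplit : W.HasSplitMultiplicativeReductionAtPrime p
  · exact missingUpperBoundAt_of_katoSurj_split_of_schneider W p hK hJs hHs hD hGZK hpar hp5 hmult
      hsplit hr hρ (hstar hsplit) hReg.2
  · exact missingUpperBoundAt_of_katoSurj_nonsplit_of_schneider W p hK hJn hHn hD hGZK hpar
      (by omega) hmult hsplit hr hρ hReg.1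

omit [W.IsElliptic] in
/-- On a (ram) pair Disegni's (∗) holds automatically: the (ram) prime is a second multiplicative
prime. Bookkeeping. [folklore] -/
theorem exists_second_multiplicative_prime_of_ram (hram : Ram W p) :
    ∃ (m : ℕ) (_ : Fact m.Prime), m ≠ p ∧ W.HasMultiplicativeReductionAtPrime m := by
  obtain ⟨ℓ, hℓ, hℓp, hmℓ, -⟩ := hram
  exact ⟨ℓ, hℓ, hℓp, hmℓ⟩

end Class

end Summit.BirchSwinnertonDyer.Rank1Residual.X11b

end
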